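import Summits.AtomisticToContinuum.HydrodynamicLimit.Theorems.CollisionIsometryCLTAdaptedWeightCLTBHEntropyBudgetCellLaw

/-!
# Per-contact inputs of the line `block-h-dissipation-closure` (crux `AdaptedWeightCLT`,
stmt-AtomisticToContinuum-14868; stub `stub_perContact`, `--supports`) — helper 3: kinematics of one contact
seen by one cell

For a post-collisional configuration `w`, a pair `i ≠ j` and its pre-collisional configuration
`w⁰ = collidePair i j w` (same positions, `(vᵢ⁰, vⱼ⁰) ↦ (vᵢ, vⱼ)` an elastic reflection, all other velocities
unchanged), and a cell location `x` (vocabulary `cw cW cU cT` of `…Theorems.BlockHDissipation`):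
* the cell weights do not move (`cw_collidePair`, `cW_collidePair`): only velocities jump;
* pair momentum and energy are conserved, hence the pair energy ABOUT ANY FIXED VECTOR `U` is conserved
  (`pairEnergy_collidePair`) and `|vᵢ − vᵢ⁰|² ≤ 4 E_U`, `E_U = |vᵢ⁰ − U|² + |vⱼ⁰ − U|²` (`norm_sq_vel_sub_le`);
* the CELL VELOCITY SHIFT is carried by the WEIGHT DIFFERENCE: `W (ū − ū⁰) = (cwᵢ − cwⱼ)(vᵢ − vᵢ⁰)`
  (`cW_smul_cU_sub`), so `W² |ū − ū⁰|² ≤ 4 (cwᵢ − cwⱼ)² E_U` (`cW_sq_mul_norm_cU_sub_sq_le`);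
* the CELL TEMPERATURE SHIFT (parallel-axis identity, exact):
  `3W θ̄ + W |ū − ū⁰|² = 3W θ̄⁰ + (cwᵢ − cwⱼ)(|vᵢ − ū⁰|² − |vᵢ⁰ − ū⁰|²)` (`cT_identity`), hence
  `3 W |θ̄ − θ̄⁰| ≤ 5 |cwᵢ − cwⱼ| E_{ū⁰}` (`cW_mul_abs_cT_sub_le`).
At a genuine contact `|xᵢ − xⱼ| = ε_N`, so `|cwᵢ − cwⱼ| ≤ ‖∇ψ_N‖∞ ε_N` is small RELATIVE to `cwᵢ + cwⱼ` in the bulk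
of the kernel (`(N+1)^{γc − 1/3}`): the co-moving floor barely moves at a contact. Only `|cwᵢ − cwⱼ| ≤ cwᵢ + cwⱼ`
is used downstream.
-/

namespace Summit.AtomisticToContinuum.HydrodynamicLimit.Theorems.BlockHDissipation

open scoped BigOperators Topology Classical MeasureTheory ENNReal InnerProductSpace
open Filter Set MeasureTheory
open Literature.Analysis.FluidPDE
open Summit.AtomisticToContinuum.HydrodynamicLimit.Theorems.ContactSourceDuhamel (T3 V3 Cfg Vel Flow Flows)

noncomputable section

namespace PerContact

open EntropyBudget

variable {N : ℕ} {ψ : ℕ → T3 → ℝ} (w : Cfg N) (x : T3) {i j : Fin (N + 1)}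

/-! ## Weights and velocities across the contact -/

/-- The cell weights do not move at a contact (positions are unchanged). -/
theorem cw_collidePair (i j k : Fin (N + 1)) :
    cw N ψ (collidePair (Torus.geometry (Fin 3)) i j w) x k = cw N ψ w x k := by
  simp only [cw, collidePair_apply_fst]

/-- The total cell weight does not move at a contact. -/
theorem cW_collidePair (i j : Fin (N + 1)) : cW N ψ (collidePair (Torus.geometry (Fin 3)) i j w) x = cW N ψ w x := by
  simp only [cW, cw_collidePair]

/-- Spectator velocities are unchanged. -/
theorem vel_collidePair_of_ne {k : Fin (N + 1)} (hki : k ≠ i) (hkj : k ≠ j) :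
    ((collidePair (Torus.geometry (Fin 3)) i j w) k).2 = (w k).2 := by
  rw [collidePair_apply_of_ne hki hkj]

/-- Conservation of the pair momentum. -/
theorem vel_add_vel_collidePair (hij : i ≠ j) :
    ((collidePair (Torus.geometry (Fin 3)) i j w) i).2 + ((collidePair (Torus.geometry (Fin 3)) i j w) j).2 =
      (w i).2 + (w j).2 := by
  rw [collidePair_apply_left hij, collidePair_apply_right]
  exact reflectVel_fst_add_reflectVel_snd _ _

/-- Conservation of the pair kinetic energy. -/
theorem norm_sq_add_collidePair (hij : i ≠ j) :
    ‖((collidePair (Torus.geometry (Fin 3)) i j w) i).2‖ ^ 2 + ‖((collidePair (Torus.geometry (Fin 3)) i j w) j).2‖ ^ 2 =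
      ‖(w i).2‖ ^ 2 + ‖(w j).2‖ ^ 2 := by
  rw [collidePair_apply_left hij, collidePair_apply_right]
  exact norm_sq_reflectVel_fst_add_norm_sq_reflectVel_snd _ _

/-- Conservation of the PAIR ENERGY ABOUT ANY FIXED VECTOR `U`:
`|vᵢ⁰ − U|² + |vⱼ⁰ − U|² = |vᵢ − U|² + |vⱼ − U|²`. -/
theorem pairEnergy_collidePair (hij : i ≠ j) (U : V3) :
    ‖((collidePair (Torus.geometry (Fin 3)) i j w) i).2 - U‖ ^ 2 + ‖((collidePair (Torus.geometry (Fin 3)) i j w) j).2 - U‖ ^ 2 =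
      ‖(w i).2 - U‖ ^ 2 + ‖(w j).2 - U‖ ^ 2 := by
  have h1 := vel_add_vel_collidePair w hij
  have h2 := norm_sq_add_collidePair w hij
  have h3 : ⟪((collidePair (Torus.geometry (Fin 3)) i j w) i).2, U⟫_ℝ +
      ⟪((collidePair (Torus.geometry (Fin 3)) i j w) j).2, U⟫_ℝ = ⟪(w i).2, U⟫_ℝ + ⟪(w j).2, U⟫_ℝ := by
    rw [← inner_add_left, ← inner_add_left, h1]
  simp only [norm_sub_sq_real]
  linarith

/-- The velocity jump of particle `i` is controlled by the pair energy about any vector: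
`|vᵢ − vᵢ⁰|² ≤ 4 (|vᵢ⁰ − U|² + |vⱼ⁰ − U|²)`. -/
theorem norm_sq_vel_sub_le (hij : i ≠ j) (U : V3) :
    ‖(w i).2 - ((collidePair (Torus.geometry (Fin 3)) i j w) i).2‖ ^ 2 ≤
      4 * (‖((collidePair (Torus.geometry (Fin 3)) i j w) i).2 - U‖ ^ 2 +
        ‖((collidePair (Torus.geometry (Fin 3)) i j w) j).2 - U‖ ^ 2) := by
  have hE := pairEnergy_collidePair w hij U
  have hpar : ‖(w i).2 - ((collidePair (Torus.geometry (Fin 3)) i j w) i).2‖ ^ 2 ≤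
      2 * ‖(w i).2 - U‖ ^ 2 + 2 * ‖((collidePair (Torus.geometry (Fin 3)) i j w) i).2 - U‖ ^ 2 := by
    have e : (w i).2 - ((collidePair (Torus.geometry (Fin 3)) i j w) i).2 =
        ((w i).2 - U) - (((collidePair (Torus.geometry (Fin 3)) i j w) i).2 - U) := by abel
    rw [e]
    have := norm_sub_le ((w i).2 - U) (((collidePair (Torus.geometry (Fin 3)) i j w) i).2 - U)
    nlinarith [norm_nonneg ((w i).2 - U - (((collidePair (Torus.geometry (Fin 3)) i j w) i).2 - U)),
      norm_nonneg ((w i).2 - U), norm_nonneg (((collidePair (Torus.geometry (Fin 3)) i j w) i).2 - U),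
      sq_nonneg (‖(w i).2 - U‖ - ‖((collidePair (Torus.geometry (Fin 3)) i j w) i).2 - U‖)]
  nlinarith [sq_nonneg ‖(w j).2 - U‖, sq_nonneg ‖((collidePair (Torus.geometry (Fin 3)) i j w) j).2 - U‖]

/-! ## The cell velocity shift -/

/-- The weighted momentum jump is carried by the weight difference:
`Σₖ cwₖ vₖ − Σₖ cwₖ vₖ⁰ = (cwᵢ − cwⱼ)(vᵢ − vᵢ⁰)`. -/
theorem sum_cw_smul_vel_sub (hij : i ≠ j) :
    ∑ k, cw N ψ w x k • (w k).2 - ∑ k, cw N ψ w x k • ((collidePair (Torus.geometry (Fin 3)) i j w) k).2 =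
      (cw N ψ w x i - cw N ψ w x j) • ((w i).2 - ((collidePair (Torus.geometry (Fin 3)) i j w) i).2) := by
  rw [← Finset.sum_sub_distrib]
  rw [Fintype.sum_eq_add i j hij fun k hk => by
    rw [vel_collidePair_of_ne w hk.1 hk.2, sub_self]]
  have hj : (w j).2 - ((collidePair (Torus.geometry (Fin 3)) i j w) j).2 =
      -((w i).2 - ((collidePair (Torus.geometry (Fin 3)) i j w) i).2) := by
    have h1 := vel_add_vel_collidePair w hij
    rw [neg_sub, sub_eq_sub_iff_add_eq_add, add_comm, ← h1]
  rw [← smul_sub, ← smul_sub, hj, smul_neg, sub_smul]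
  abel

/-- **CELL VELOCITY SHIFT**: `W (ū − ū⁰) = (cwᵢ − cwⱼ)(vᵢ − vᵢ⁰)` (nonnegative kernel). -/
theorem cW_smul_cU_sub (hψ : ∀ y, 0 ≤ ψ N y) (hij : i ≠ j) :
    cW N ψ w x • (cU N ψ w x - cU N ψ (collidePair (Torus.geometry (Fin 3)) i j w) x) =
      (cw N ψ w x i - cw N ψ w x j) • ((w i).2 - ((collidePair (Torus.geometry (Fin 3)) i j w) i).2) := by
  have h1 := sum_cw_smul_vel w x hψ
  have h0 := sum_cw_smul_vel (collidePair (Torus.geometry (Fin 3)) i j w) x hψ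
  simp only [cw_collidePair, cW_collidePair] at h0
  rw [smul_sub, ← h1, ← h0]
  exact sum_cw_smul_vel_sub w x hij

/-- `|cwᵢ − cwⱼ| ≤ cW` (indeed `≤ cwᵢ + cwⱼ ≤ cW`). -/
theorem abs_cw_sub_cw_le (hψ : ∀ y, 0 ≤ ψ N y) (i j : Fin (N + 1)) :
    |cw N ψ w x i - cw N ψ w x j| ≤ cW N ψ w x := by
  have hi := cw_le_cW w x hψ i
  have hj := cw_le_cW w x hψ j
  have hi0 := cw_nonneg w x hψ i
  have hj0 := cw_nonneg w x hψ j
  rw [abs_le]; constructor <;> linarith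

/-- `|cwᵢ − cwⱼ| ≤ cwᵢ + cwⱼ`. -/
theorem abs_cw_sub_cw_le_add (hψ : ∀ y, 0 ≤ ψ N y) (i j : Fin (N + 1)) :
    |cw N ψ w x i - cw N ψ w x j| ≤ cw N ψ w x i + cw N ψ w x j := by
  have hi0 := cw_nonneg w x hψ i
  have hj0 := cw_nonneg w x hψ j
  rw [abs_le]; constructor <;> linarith

/-- **SIZE OF THE CELL VELOCITY SHIFT**: `W² |ū − ū⁰|² ≤ 4 (cwᵢ − cwⱼ)² E_U` for every `U`. -/
theorem cW_sq_mul_norm_cU_sub_sq_le (hψ : ∀ y, 0 ≤ ψ N y) (hij : i ≠ j) (U : V3) :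
    cW N ψ w x ^ 2 * ‖cU N ψ w x - cU N ψ (collidePair (Torus.geometry (Fin 3)) i j w) x‖ ^ 2 ≤
      4 * (cw N ψ w x i - cw N ψ w x j) ^ 2 * (‖((collidePair (Torus.geometry (Fin 3)) i j w) i).2 - U‖ ^ 2 +
        ‖((collidePair (Torus.geometry (Fin 3)) i j w) j).2 - U‖ ^ 2) := by
  have h := cW_smul_cU_sub w x hψ hij
  have hn := congrArg (fun v : V3 => ‖v‖ ^ 2) h
  simp only [norm_smul, mul_pow, Real.norm_eq_abs, sq_abs] at hn
  rw [hn]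
  have hv := norm_sq_vel_sub_le w hij U
  nlinarith [sq_nonneg (cw N ψ w x i - cw N ψ w x j)]

/-! ## The cell temperature shift -/

/-- `3 W θ̄ = Σₖ cwₖ |vₖ − ū|²` (in an empty cell both sides vanish). -/
theorem three_mul_cW_mul_cT (hψ : ∀ y, 0 ≤ ψ N y) (w' : Cfg N) :
    3 * (cW N ψ w' x * cT N ψ w' x) = ∑ k, cw N ψ w' x k * ‖(w' k).2 - cU N ψ w' x‖ ^ 2 := by
  by_cases hS : cW N ψ w' x = 0
  · rw [hS, zero_mul, mul_zero]
    exact (Finset.sum_eq_zero fun k _ => by rw [cw_eq_zero_of_cW w' x hψ hS k, zero_mul]).symm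
  · unfold cT
    rw [← mul_assoc (cW N ψ w' x), mul_inv_cancel₀ hS, one_mul, Finset.mul_sum]
    exact Finset.sum_congr rfl fun k _ => by ring

/-- PARALLEL-AXIS IDENTITY: `Σₖ cwₖ |vₖ − U'|² = Σₖ cwₖ |vₖ − ū|² + W |ū − U'|²`. -/
theorem sum_cw_mul_norm_sub_sq (hψ : ∀ y, 0 ≤ ψ N y) (w' : Cfg N) (U' : V3) :
    ∑ k, cw N ψ w' x k * ‖(w' k).2 - U'‖ ^ 2 =
      ∑ k, cw N ψ w' x k * ‖(w' k).2 - cU N ψ w' x‖ ^ 2 + cW N ψ w' x * ‖cU N ψ w' x - U'‖ ^ 2 := by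
  have hmom := sum_cw_smul_vel w' x hψ
  have hexp : ∀ k, cw N ψ w' x k * ‖(w' k).2 - U'‖ ^ 2 = cw N ψ w' x k * ‖(w' k).2 - cU N ψ w' x‖ ^ 2 +
      2 * ⟪cw N ψ w' x k • ((w' k).2 - cU N ψ w' x), cU N ψ w' x - U'⟫_ℝ + cw N ψ w' x k * ‖cU N ψ w' x - U'‖ ^ 2 := by
    intro k
    have e : (w' k).2 - U' = ((w' k).2 - cU N ψ w' x) + (cU N ψ w' x - U') := by abel
    rw [e, norm_add_sq_real, real_inner_smul_left]
    ring
  simp_rw [hexp]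
  rw [Finset.sum_add_distrib, Finset.sum_add_distrib, ← Finset.mul_sum, ← sum_inner, ← Finset.sum_mul]
  have hzero : ∑ k, cw N ψ w' x k • ((w' k).2 - cU N ψ w' x) = 0 := by
    simp_rw [smul_sub]
    rw [Finset.sum_sub_distrib, hmom, ← Finset.sum_smul]
    exact sub_self _
  rw [hzero, inner_zero_left, mul_zero, add_zero]
  rfl

/-- **CELL TEMPERATURE IDENTITY ACROSS A CONTACT** (exact):
`3W θ̄ + W |ū − ū⁰|² = 3W θ̄⁰ + (cwᵢ − cwⱼ)(|vᵢ − ū⁰|² − |vᵢ⁰ − ū⁰|²)`. -/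
theorem cT_identity (hψ : ∀ y, 0 ≤ ψ N y) (hij : i ≠ j) :
    3 * (cW N ψ w x * cT N ψ w x) +
        cW N ψ w x * ‖cU N ψ w x - cU N ψ (collidePair (Torus.geometry (Fin 3)) i j w) x‖ ^ 2 =
      3 * (cW N ψ w x * cT N ψ (collidePair (Torus.geometry (Fin 3)) i j w) x) +
        (cw N ψ w x i - cw N ψ w x j) *
          (‖(w i).2 - cU N ψ (collidePair (Torus.geometry (Fin 3)) i j w) x‖ ^ 2 -
            ‖((collidePair (Torus.geometry (Fin 3)) i j w) i).2 - cU N ψ (collidePair (Torus.geometry (Fin 3)) i j w) x‖ ^ 2) := by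
  set w₀ := collidePair (Torus.geometry (Fin 3)) i j w with hw₀
  set U₀ := cU N ψ w₀ x with hU₀
  -- left side = Σ cw |v_k − U₀|²
  have hL : 3 * (cW N ψ w x * cT N ψ w x) + cW N ψ w x * ‖cU N ψ w x - U₀‖ ^ 2 =
      ∑ k, cw N ψ w x k * ‖(w k).2 - U₀‖ ^ 2 := by
    rw [three_mul_cW_mul_cT x hψ w, sum_cw_mul_norm_sub_sq x hψ w U₀]
  -- right side: Σ cw |v_k⁰ − U₀|² = 3 W θ̄⁰
  have hR : 3 * (cW N ψ w x * cT N ψ w₀ x) = ∑ k, cw N ψ w x k * ‖(w₀ k).2 - U₀‖ ^ 2 := by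
    have h := three_mul_cW_mul_cT x hψ w₀
    simp only [hw₀, cw_collidePair, cW_collidePair] at h ⊢
    exact h
  -- the two sums differ only at `i` and `j`
  have hdiff : ∑ k, cw N ψ w x k * ‖(w k).2 - U₀‖ ^ 2 - ∑ k, cw N ψ w x k * ‖(w₀ k).2 - U₀‖ ^ 2 =
      cw N ψ w x i * (‖(w i).2 - U₀‖ ^ 2 - ‖(w₀ i).2 - U₀‖ ^ 2) +
        cw N ψ w x j * (‖(w j).2 - U₀‖ ^ 2 - ‖(w₀ j).2 - U₀‖ ^ 2) := by
    rw [← Finset.sum_sub_distrib]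
    rw [Fintype.sum_eq_add i j hij fun k hk => by
      rw [hw₀, vel_collidePair_of_ne w hk.1 hk.2, sub_self]]
    ring
  have hE := pairEnergy_collidePair w hij U₀
  rw [hL, hR]
  have hj : ‖(w j).2 - U₀‖ ^ 2 - ‖(w₀ j).2 - U₀‖ ^ 2 = -(‖(w i).2 - U₀‖ ^ 2 - ‖(w₀ i).2 - U₀‖ ^ 2) := by
    rw [← hw₀] at hE; linarith
  rw [hj] at hdiff
  linarith

/-- **SIZE OF THE CELL TEMPERATURE SHIFT**: `3 W |θ̄ − θ̄⁰| ≤ 5 |cwᵢ − cwⱼ| E_{ū⁰}`,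
`E_{ū⁰} = |vᵢ⁰ − ū⁰|² + |vⱼ⁰ − ū⁰|²`. -/
theorem cW_mul_abs_cT_sub_le (hψ : ∀ y, 0 ≤ ψ N y) (hij : i ≠ j) :
    3 * (cW N ψ w x * |cT N ψ w x - cT N ψ (collidePair (Torus.geometry (Fin 3)) i j w) x|) ≤
      5 * |cw N ψ w x i - cw N ψ w x j| *
        (‖((collidePair (Torus.geometry (Fin 3)) i j w) i).2 - cU N ψ (collidePair (Torus.geometry (Fin 3)) i j w) x‖ ^ 2 +
          ‖((collidePair (Torus.geometry (Fin 3)) i j w) j).2 - cU N ψ (collidePair (Torus.geometry (Fin 3)) i j w) x‖ ^ 2) := by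
  set w₀ := collidePair (Torus.geometry (Fin 3)) i j w with hw₀
  set U₀ := cU N ψ w₀ x with hU₀
  set E : ℝ := ‖(w₀ i).2 - U₀‖ ^ 2 + ‖(w₀ j).2 - U₀‖ ^ 2 with hEdef
  set d : ℝ := cw N ψ w x i - cw N ψ w x j with hd
  have hW0 := cW_nonneg w x hψ
  have hE0 : 0 ≤ E := by positivity
  have hid := cT_identity w x hψ hij
  have hEc := pairEnergy_collidePair w hij U₀
  have hdW : |d| ≤ cW N ψ w x := abs_cw_sub_cw_le w x hψ i j
  have hU := cW_sq_mul_norm_cU_sub_sq_le w x hψ hij U₀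
  rw [← hw₀, ← hU₀, ← hd] at hid hU
  rw [← hw₀] at hEc
  -- `|A − B| ≤ E` for the single-particle energies `A = |vᵢ − U₀|²`, `B = |vᵢ⁰ − U₀|²`
  have hA : ‖(w i).2 - U₀‖ ^ 2 ≤ E := by rw [hEdef, hEc]; nlinarith [sq_nonneg ‖(w j).2 - U₀‖]
  have hB : ‖(w₀ i).2 - U₀‖ ^ 2 ≤ E := by rw [hEdef]; nlinarith [sq_nonneg ‖(w₀ j).2 - U₀‖]
  have hAB : |‖(w i).2 - U₀‖ ^ 2 - ‖(w₀ i).2 - U₀‖ ^ 2| ≤ E := by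
    rw [abs_le]; constructor <;> nlinarith [sq_nonneg ‖(w i).2 - U₀‖, sq_nonneg ‖(w₀ i).2 - U₀‖]
  -- `W · 3W|Δθ| ≤ W |d| E + W² |ΔU|² ≤ |d| E W + 4 d² E ≤ 5 |d| E W`
  by_cases hS : cW N ψ w x = 0
  · rw [hS, zero_mul, mul_zero]; positivity
  have hSpos : 0 < cW N ψ w x := lt_of_le_of_ne hW0 (Ne.symm hS)
  have key : cW N ψ w x * (3 * (cW N ψ w x * |cT N ψ w x - cT N ψ w₀ x|)) ≤ cW N ψ w x * (5 * |d| * E) := by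
    have h1 : 3 * (cW N ψ w x * (cT N ψ w x - cT N ψ w₀ x)) =
        d * (‖(w i).2 - U₀‖ ^ 2 - ‖(w₀ i).2 - U₀‖ ^ 2) - cW N ψ w x * ‖cU N ψ w x - U₀‖ ^ 2 := by linarith
    have h2 : cW N ψ w x * (3 * (cW N ψ w x * |cT N ψ w x - cT N ψ w₀ x|)) =
        cW N ψ w x * |d * (‖(w i).2 - U₀‖ ^ 2 - ‖(w₀ i).2 - U₀‖ ^ 2) - cW N ψ w x * ‖cU N ψ w x - U₀‖ ^ 2| := by
      rw [← h1, abs_mul, abs_mul, abs_of_pos hSpos, abs_of_pos (by norm_num : (0 : ℝ) < 3)]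
    rw [h2]
    have h3 : |d * (‖(w i).2 - U₀‖ ^ 2 - ‖(w₀ i).2 - U₀‖ ^ 2) - cW N ψ w x * ‖cU N ψ w x - U₀‖ ^ 2| ≤
        |d| * E + cW N ψ w x * ‖cU N ψ w x - U₀‖ ^ 2 := by
      refine (abs_sub _ _).trans (add_le_add ?_ ?_)
      · rw [abs_mul]; exact mul_le_mul_of_nonneg_left hAB (abs_nonneg _)
      · rw [abs_of_nonneg (by positivity)]
    have h4 : cW N ψ w x * (cW N ψ w x * ‖cU N ψ w x - U₀‖ ^ 2) ≤ 4 * d ^ 2 * E := by nlinarith [hU]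
    have h5 : 4 * d ^ 2 * E ≤ 4 * (|d| * cW N ψ w x) * E := by
      have : d ^ 2 = |d| * |d| := by rw [← sq_abs, sq]
      rw [this]
      exact mul_le_mul_of_nonneg_right (mul_le_mul_of_nonneg_left (mul_le_mul_of_nonneg_left hdW (abs_nonneg d))
        (by norm_num)) hE0
    nlinarith [mul_le_mul_of_nonneg_left h3 hW0, abs_nonneg d]
  exact le_of_mul_le_mul_left key hSpos

end PerContact

/-- Registered anchor of this helper file (`--supports stmt-AtomisticToContinuum-14868`, helper of
`stub_perContact`): the cell velocity shift at a contact is carried by the weight difference,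
`W (ū − ū⁰) = (cwᵢ − cwⱼ)(vᵢ − vᵢ⁰)`. -/
theorem bhPerContact_kinematics_anchor : ∀ (N : ℕ) (ψ : ℕ → T3 → ℝ) (w : Cfg N) (x : T3) (i j : Fin (N + 1)), (∀ y, 0 ≤ ψ N y) → i ≠ j → cW N ψ w x • (cU N ψ w x - cU N ψ (Literature.Analysis.FluidPDE.collidePair (Literature.Analysis.FluidPDE.Torus.geometry (Fin 3)) i j w) x) = (cw N ψ w x i - cw N ψ w x j) • ((w i).2 - ((Literature.Analysis.FluidPDE.collidePair (Literature.Analysis.FluidPDE.Torus.geometry (Fin 3)) i j w) i).2) :=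
  fun _ _ w x _ _ hψ hij => PerContact.cW_smul_cU_sub w x hψ hij

end

end Summit.AtomisticToContinuum.HydrodynamicLimit.Theorems.BlockHDissipation
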